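import Summits.NavierStokesRegularity.NavierStokesRegularity.Theorems.SymmetryModuliCountStretchingCertificateComparisonMaxPrinciple
import Summits.NavierStokesRegularity.NavierStokesRegularity.Theorems.SymmetryModuliCountStretchingCertificateComparisonKato
import Literature.Analysis.FluidPDE.NSVorticityBKMTools
import HarnessLib

/-!
# Route TypeICertificateLadder — the weighted vorticity bound under a strain bound
  (a-priori estimate behind C32 of cell pub-ns-dss, the explicit STRAIN-rate constant `1` at a
  singular time; helper of crux stmt-NavierStokesRegularity-2882)

For a classical solution `(u, p)` of unforced Navier–Stokes (`ν > 0`) on `ℝ³ × [0, T)` in the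
Beale–Kato–Majda class (all `L²` Sobolev norms bounded on every `[0, T'']`, `T'' < T`): if the strain
satisfies `(T − t)⟪∇u(t,x) ξ, ξ⟫ ≤ θ‖ξ‖²` for all `x, ξ` and `t ∈ (t₀, T)` (`θ ≥ 0`), then the
weighted enstrophy density `P = (T − t)^{2θ}|ω|²` is bounded on `[t₀, T) × ℝ³` by its initial
supremum. Mechanism (elementary, NO Liouville theorem): Kato's identity
`∂ₜ|ω|² + u·∇|ω|² − νΔ|ω|² = 2⟪∇u ω, ω⟫ − 2ν|∇ω|²_F ≤ 2θ|ω|²/(T − t)`; the weight absorbs the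
zeroth-order term exactly, so `∂ₜP ≤ νΔP − u·∇P ≤ νΔP + ‖u‖_∞‖∇P‖`, and the tree's whole-space
weak maximum principle (`le_of_subsolution_linear_drift`, Lieberman 1996 Ch. II, here with a
viscosity by time rescaling) applies on every `[t₀, T₂]`, `T₂ < T`, the BKM-class Sobolev sup
bounds (`exists_forall_norm_iteratedFDeriv_le_bkmClass`) providing boundedness.

* `le_of_subsolution_linear_drift_viscosity` — the maximum principle with diffusion coefficient `ν`.
* `strainWeight_algebra` — the real-arithmetic core of the Kato computation.
* `weightedVorticity_le_of_strain_bound` — the bound.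

HONEST FRAMING: an a-priori estimate about a HYPOTHETICAL solution; nothing here bears on the
regularity question itself. Lands `--supports stmt-NavierStokesRegularity-2882`.
-/

noncomputable section

namespace Summit.NavierStokesRegularity.NavierStokesRegularity.Theorems

set_option linter.dupNamespace false

open MeasureTheory Set Filter Topology Function
open scoped RealInnerProductSpace Laplacian ContDiff
open Literature.Analysis Literature.Analysis.FluidPDE

/-! ### The whole-space maximum principle with a viscosity -/

/-- **Weak maximum principle on `[T₁, T₂] × ℝ³` with diffusion coefficient `ν > 0`**: the tree's
`le_of_subsolution_linear_drift` (Lieberman 1996, Ch. II) for `Pₜ ≤ νΔP + K(1 + ‖x‖)‖∇P‖`, by the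
time rescaling `Q(s, x) = P(s/ν, x)` (`Qₛ = ν⁻¹Pₜ ≤ ΔQ + (K/ν)(1 + ‖x‖)‖∇Q‖`).
[cite: Lieberman1996, Ch. II Lemma 2.1 and Lemma 2.3; Thm. 2.4 (unbounded domains)] -/
theorem le_of_subsolution_linear_drift_viscosity {ν T₁ T₂ M B K : ℝ} (hν : 0 < ν) (hK : 0 ≤ K)
    {P Pₜ : ℝ → EuclideanSpace ℝ (Fin 3) → ℝ}
    (hc : ContinuousOn (uncurry P) (Icc T₁ T₂ ×ˢ univ))
    (h2 : ∀ t ∈ Ioc T₁ T₂, ContDiff ℝ 2 (P t))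
    (ht : ∀ t ∈ Ioc T₁ T₂, ∀ x, HasDerivAt (fun s => P s x) (Pₜ t x) t)
    (hsub : ∀ t ∈ Ioc T₁ T₂, ∀ x,
      Pₜ t x ≤ ν * (Δ (P t)) x + K * (1 + ‖x‖) * ‖fderiv ℝ (P t) x‖)
    (hB : ∀ t ∈ Icc T₁ T₂, ∀ x, P t x ≤ B) (hM : ∀ x, P T₁ x ≤ M) :
    ∀ t ∈ Icc T₁ T₂, ∀ x, P t x ≤ M := by
  have hν0 : ν ≠ 0 := hν.ne'
  have hνinv : 0 < ν⁻¹ := inv_pos.2 hν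
  set Q : ℝ → EuclideanSpace ℝ (Fin 3) → ℝ := fun s x => P (ν⁻¹ * s) x with hQ
  set Qₜ : ℝ → EuclideanSpace ℝ (Fin 3) → ℝ := fun s x => Pₜ (ν⁻¹ * s) x * ν⁻¹ with hQₜ
  have hIcc : ∀ {s : ℝ}, s ∈ Icc (ν * T₁) (ν * T₂) → ν⁻¹ * s ∈ Icc T₁ T₂ := fun {s} hs => by
    constructor
    · rw [le_inv_mul_iff₀ hν]; exact hs.1
    · rw [inv_mul_le_iff₀ hν]; exact hs.2
  have hIoc : ∀ {s : ℝ}, s ∈ Ioc (ν * T₁) (ν * T₂) → ν⁻¹ * s ∈ Ioc T₁ T₂ := fun {s} hs => by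
    constructor
    · rw [lt_inv_mul_iff₀ hν]; exact hs.1
    · rw [inv_mul_le_iff₀ hν]; exact hs.2
  have key : ∀ s ∈ Icc (ν * T₁) (ν * T₂), ∀ x, Q s x ≤ M := by
    refine le_of_subsolution_linear_drift (K := K / ν) (B := B) (Pₜ := Qₜ) (by positivity)
      ?_ ?_ ?_ ?_ ?_ ?_
    · have hφ : Continuous fun z : ℝ × EuclideanSpace ℝ (Fin 3) => (ν⁻¹ * z.1, z.2) :=
        (continuous_fst.const_mul _).prodMk continuous_snd
      have hmaps : MapsTo (fun z : ℝ × EuclideanSpace ℝ (Fin 3) => (ν⁻¹ * z.1, z.2))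
          (Icc (ν * T₁) (ν * T₂) ×ˢ univ) (Icc T₁ T₂ ×ˢ univ) := fun z hz =>
        ⟨hIcc (mem_prod.1 hz).1, mem_univ _⟩
      exact (hc.comp hφ.continuousOn hmaps).congr fun z _ => rfl
    · intro s hs; exact h2 _ (hIoc hs)
    · intro s hs x
      have hlin : HasDerivAt (fun σ : ℝ => ν⁻¹ * σ) ν⁻¹ s := by
        simpa using (hasDerivAt_id s).const_mul ν⁻¹
      exact (ht _ (hIoc hs) x).comp s hlin
    · intro s hs x
      have h := mul_le_mul_of_nonneg_right (hsub _ (hIoc hs) x) hνinv.le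
      show Pₜ (ν⁻¹ * s) x * ν⁻¹ ≤
        (Δ (P (ν⁻¹ * s))) x + K / ν * (1 + ‖x‖) * ‖fderiv ℝ (P (ν⁻¹ * s)) x‖
      calc Pₜ (ν⁻¹ * s) x * ν⁻¹
          ≤ (ν * (Δ (P (ν⁻¹ * s))) x + K * (1 + ‖x‖) * ‖fderiv ℝ (P (ν⁻¹ * s)) x‖) * ν⁻¹ := h
        _ = (Δ (P (ν⁻¹ * s))) x + K / ν * (1 + ‖x‖) * ‖fderiv ℝ (P (ν⁻¹ * s)) x‖ := by
            field_simp
    · intro s hs x; exact hB _ (hIcc hs) x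
    · intro x
      show P (ν⁻¹ * (ν * T₁)) x ≤ M
      rw [inv_mul_cancel_left₀ hν0]; exact hM x
  intro t htI x
  have h := key (ν * t) ⟨mul_le_mul_of_nonneg_left htI.1 hν.le,
    mul_le_mul_of_nonneg_left htI.2 hν.le⟩ x
  simpa only [hQ, inv_mul_cancel_left₀ hν0] using h

/-! ### Kato's computation for the weighted enstrophy density -/

/-- **The real-arithmetic core.** With `ω' + Dω(u) = Du(ω) + νΔω` (the vorticity equation at a
point), `F = |ω|²`, `dF = 2⟪ω, ω'⟫`, `ΔF = 2⟪Δω, ω⟫ + 2|∇ω|²_F`, `∇F·u = 2⟪ω, Dω(u)⟫`, the strain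
bound `⟪Du ω, ω⟫ ≤ κ|ω|²` and a weight `c ≥ 0` with `c' = −2κc`:
`c'F + c·dF ≤ ν c ΔF − c ∇F·u`. [folklore] -/
theorem strainWeight_algebra {ωx ω' Duω Lω Dωu : EuclideanSpace ℝ (Fin 3)}
    {ν c c' κ frob : ℝ} (hveq : ω' + Dωu = Duω + ν • Lω) (hfrob : 0 ≤ frob) (hν : 0 ≤ ν)
    (hstrain : ⟪Duω, ωx⟫ ≤ κ * ‖ωx‖ ^ 2) (hc : 0 ≤ c) (hc' : c' = -(2 * κ) * c) :
    c' * ‖ωx‖ ^ 2 + c * (2 * ⟪ωx, ω'⟫) ≤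
      ν * (c * (2 * ⟪Lω, ωx⟫ + 2 * frob)) - c * (2 * ⟪ωx, Dωu⟫) := by
  have hω' : ω' = Duω + ν • Lω - Dωu := eq_sub_of_add_eq hveq
  have hinner : ⟪ωx, ω'⟫ = ⟪Duω, ωx⟫ + ν * ⟪Lω, ωx⟫ - ⟪ωx, Dωu⟫ := by
    rw [hω', inner_sub_right, inner_add_right, real_inner_smul_right, real_inner_comm Duω ωx,
      real_inner_comm Lω ωx]
  rw [hinner, hc']
  have h1 : c * ⟪Duω, ωx⟫ ≤ c * (κ * ‖ωx‖ ^ 2) := mul_le_mul_of_nonneg_left hstrain hc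
  have h2 : 0 ≤ ν * c * frob := by positivity
  nlinarith [h1, h2]

/-! ### The weighted vorticity bound under the strain bound -/

/-- **`(T − t)^{2θ}‖ω(t,x)‖² ≤ (T − t₀)^{2θ} sup‖ω(t₀)‖²` on `[t₀, T)` under the strain bound.** Let
`(u, p)` be a classical solution of unforced Navier–Stokes (`ν > 0`) on `ℝ³ × [0,T)` in the BKM class
on every `[0,T'']`, `T'' < T`, and suppose `(T − t)⟪∇u(t,x) ξ, ξ⟫ ≤ θ‖ξ‖²` for all `x, ξ` and all
`t ∈ (t₀, T)` (`0 < t₀ < T`, `0 ≤ θ`). Then `P = (T − t)^{2θ}|ω|²` is bounded on `[t₀, T) × ℝ³` by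
`M = (T − t₀)^{2θ} B₀²`, `B₀ = sup‖ω(t₀)‖`: `P` is a bounded (Sobolev sup bounds,
`exists_forall_norm_iteratedFDeriv_le_bkmClass`) subsolution of `∂ₜP ≤ νΔP + ‖u‖_∞‖∇P‖` on every
`[t₀, T₂]`, `T₂ < T` (`strainWeight_algebra` on the vorticity equation
`IsClassicalNSSolutionOn.isVorticitySolutionOn_zero_force`), and `le_of_subsolution_linear_drift_viscosity`
applies. [folklore] -/
theorem weightedVorticity_le_of_strain_bound {ν T θ t₀ : ℝ} (hν : 0 < ν) (hθ : 0 ≤ θ)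
    (ht₀ : 0 < t₀) (ht₀T : t₀ < T)
    {u : ℝ → EuclideanSpace ℝ (Fin 3) → EuclideanSpace ℝ (Fin 3)}
    {p : ℝ → EuclideanSpace ℝ (Fin 3) → ℝ}
    (hsol : IsClassicalNSSolutionOn (Ico 0 T) ν 0 u p)
    (hreg : ∀ T'' < T, HasBoundedSobolevNormsOn (Icc 0 T'') u)
    (hstrain : ∀ t ∈ Ioo t₀ T, ∀ x ξ : EuclideanSpace ℝ (Fin 3),
      (T - t) * ⟪fderiv ℝ (u t) x ξ, ξ⟫ ≤ θ * ‖ξ‖ ^ 2) :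
    ∃ M : ℝ, ∀ t ∈ Ico t₀ T, ∀ x, (T - t) ^ (2 * θ) * ‖curl (u t) x‖ ^ 2 ≤ M := by
  -- the solution on the open slab and its vorticity equation (two-sided time derivative)
  have hsolo : IsClassicalNSSolutionOn (Ioo 0 T) ν 0 u p :=
    hsol.mono Ioo_subset_Ico_self isOpen_Ioo.uniqueDiffOn
  have hsm : IsSmoothSpaceTimeOn (Ioo 0 T) u := hsolo.smooth_velocity
  have hvort : IsSmoothSpaceTimeOn (Ioo 0 T) (vorticity u) := by
    have h1 := (hsm.isSmoothSpaceTimeOn_fderiv_of_isOpen isOpen_Ioo).clm curlCLM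
    have e : (fun t x => curlCLM (fderiv ℝ (u t) x)) = vorticity u := by funext s y; rfl
    rwa [e] at h1
  have hV := hsolo.isVorticitySolutionOn_zero_force isOpen_Ioo.uniqueDiffOn
    (by rw [interior_Ioo]; exact subset_closure)
  have hveq : ∀ t ∈ Ioo 0 T, ∀ x,
      deriv (fun s => curl (u s) x) t + fderiv ℝ (curl (u t)) x (u t x) =
        fderiv ℝ (u t) x (curl (u t) x) + ν • (Δ (curl (u t))) x := by
    intro t ht x
    have h := hV.vorticity_eq t ht x
    simp only [timeDerivWithin_eq_deriv isOpen_Ioo ht, convect_apply, vorticity_apply] at h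
    exact h
  -- smoothness of the slices
  have hsmooth : ∀ t ∈ Ico 0 T, ContDiff ℝ ∞ (u t) := fun t ht => hsol.contDiff_velocity ht
  -- the bound at the initial time `t₀`
  obtain ⟨B₁, hB₁0, hB₁⟩ := exists_forall_norm_iteratedFDeriv_le_bkmClass
    (fun t ht => hsmooth t ⟨ht.1, ht.2.trans_lt ht₀T⟩) (hreg t₀ ht₀T) 1
  set κ₀ : ℝ := ‖(curlCLM : (EuclideanSpace ℝ (Fin 3) →L[ℝ] EuclideanSpace ℝ (Fin 3)) →L[ℝ]
    EuclideanSpace ℝ (Fin 3))‖ with hκ₀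
  have hκ₀0 : 0 ≤ κ₀ := by rw [hκ₀]; positivity
  have hcurl_le : ∀ (f : EuclideanSpace ℝ (Fin 3) → EuclideanSpace ℝ (Fin 3)) (x),
      ‖curl f x‖ ≤ κ₀ * ‖iteratedFDeriv ℝ 1 f x‖ := fun f x => by
    rw [curl_eq_curlCLM, ← norm_iteratedFDeriv_fderiv, norm_iteratedFDeriv_zero]
    exact ContinuousLinearMap.le_opNorm _ _
  set M : ℝ := (T - t₀) ^ (2 * θ) * (κ₀ * B₁) ^ 2 with hMdef
  refine ⟨M, fun t ht x => ?_⟩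
  have hω₀ : ∀ y, ‖curl (u t₀) y‖ ≤ κ₀ * B₁ := fun y =>
    (hcurl_le _ y).trans (mul_le_mul_of_nonneg_left (hB₁ t₀ ⟨ht₀.le, le_rfl⟩ y) hκ₀0)
  have hPt₀ : ∀ y, (T - t₀) ^ (2 * θ) * ‖curl (u t₀) y‖ ^ 2 ≤ M := fun y => by
    rw [hMdef]
    refine mul_le_mul_of_nonneg_left ?_ (Real.rpow_nonneg (sub_pos.2 ht₀T).le _)
    exact pow_le_pow_left₀ (norm_nonneg _) (hω₀ y) 2
  rcases ht.1.eq_or_lt with rfl | ht₀t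
  · exact hPt₀ x
  -- the maximum principle on `[t₀, T₂]`, `T₂ = t`
  set T₂ : ℝ := t with hT₂
  have hT₂T : T₂ < T := ht.2
  -- uniform bounds on `[0, T₂]`: `‖u‖ ≤ K`, `‖ω‖ ≤ κ₀ B₂`
  obtain ⟨K, hK0, hK⟩ := exists_forall_norm_iteratedFDeriv_le_bkmClass
    (fun s hs => hsmooth s ⟨hs.1, hs.2.trans_lt hT₂T⟩) (hreg T₂ hT₂T) 0
  obtain ⟨B₂, hB₂0, hB₂⟩ := exists_forall_norm_iteratedFDeriv_le_bkmClass
    (fun s hs => hsmooth s ⟨hs.1, hs.2.trans_lt hT₂T⟩) (hreg T₂ hT₂T) 1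
  have huK : ∀ s ∈ Icc 0 T₂, ∀ y, ‖u s y‖ ≤ K := fun s hs y => by
    have h := hK s hs y
    rwa [norm_iteratedFDeriv_zero] at h
  have hωB : ∀ s ∈ Icc 0 T₂, ∀ y, ‖curl (u s) y‖ ≤ κ₀ * B₂ := fun s hs y =>
    (hcurl_le _ y).trans (mul_le_mul_of_nonneg_left (hB₂ s hs y) hκ₀0)
  -- the weighted density and its time derivative
  set P : ℝ → EuclideanSpace ℝ (Fin 3) → ℝ :=
    fun s y => (T - s) ^ (2 * θ) * ‖curl (u s) y‖ ^ 2 with hPdef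
  set Pₜ : ℝ → EuclideanSpace ℝ (Fin 3) → ℝ := fun s y =>
    (-1) * (2 * θ) * (T - s) ^ (2 * θ - 1) * ‖curl (u s) y‖ ^ 2 +
      (T - s) ^ (2 * θ) * (2 * ⟪curl (u s) y, deriv (fun σ => curl (u σ) y) s⟫) with hPₜdef
  have hIoc_sub : ∀ {s}, s ∈ Ioc t₀ T₂ → s ∈ Ioo 0 T := fun {s} hs =>
    ⟨ht₀.trans hs.1, hs.2.trans_lt hT₂T⟩
  have hIcc_sub : ∀ {s}, s ∈ Icc t₀ T₂ → s ∈ Ioo 0 T := fun {s} hs =>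
    ⟨ht₀.trans_le hs.1, hs.2.trans_lt hT₂T⟩
  have key := le_of_subsolution_linear_drift_viscosity (T₁ := t₀) (T₂ := T₂) (M := M)
    (B := T ^ (2 * θ) * (κ₀ * B₂) ^ 2) (K := K) (P := P) (Pₜ := Pₜ) hν hK0 ?_ ?_ ?_ ?_ ?_ ?_
  · exact key t ⟨ht₀t.le, le_rfl⟩ x
  · -- joint continuity on `[t₀, T₂] × ℝ³`
    have hw : Continuous fun z : ℝ × EuclideanSpace ℝ (Fin 3) => (T - z.1) ^ (2 * θ) :=
      (continuous_const.sub continuous_fst).rpow_const fun _ => Or.inr (by positivity)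
    have hωc : ContinuousOn (fun z : ℝ × EuclideanSpace ℝ (Fin 3) => ‖vorticity u z.1 z.2‖ ^ 2)
        (Icc t₀ T₂ ×ˢ univ) := by
      refine ((hvort.continuousOn.mono ?_).norm).pow 2
      exact prod_mono (fun s hs => hIcc_sub hs) subset_rfl
    refine (hw.continuousOn.mul hωc).congr fun z _ => ?_
    simp only [hPdef, uncurry, Pi.mul_apply, vorticity_apply]
  · -- `C²` slices
    intro s hs
    have hω : ContDiff ℝ 2 (curl (u s)) := by
      rw [← vorticity_apply]
      exact (hvort.contDiff_slice (hIoc_sub hs)).of_le (by norm_cast)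
    exact contDiff_const.mul (hω.norm_sq ℝ)
  · -- time derivative
    intro s hs y
    have hs' := hIoc_sub hs
    have hTs : 0 < T - s := sub_pos.2 hs'.2
    have hw : HasDerivAt (fun σ => (T - σ) ^ (2 * θ)) ((-1) * (2 * θ) * (T - s) ^ (2 * θ - 1)) s := by
      have h := ((hasDerivAt_id s).const_sub T).rpow_const (p := 2 * θ) (Or.inl hTs.ne')
      simpa using h
    have hωt : HasDerivAt (fun σ => curl (u σ) y) (deriv (fun σ => curl (u σ) y) s) s := by
      have h := hvort.hasDerivAt_timeLine isOpen_Ioo hs' y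
      simpa only [vorticity_apply] using h
    exact hw.mul hωt.norm_sq
  · -- the subsolution inequality
    intro s hs y
    have hs' := hIoc_sub hs
    have hTs : 0 < T - s := sub_pos.2 hs'.2
    have hω2 : ContDiff ℝ 2 (curl (u s)) := by
      rw [← vorticity_apply]
      exact (hvort.contDiff_slice hs').of_le (by norm_cast)
    have hωd : DifferentiableAt ℝ (curl (u s)) y := (hω2.differentiable (by norm_num)) y
    -- the slice `P s` is `c • |ω|²`
    set c : ℝ := (T - s) ^ (2 * θ) with hcdef
    have hc0 : 0 ≤ c := Real.rpow_nonneg hTs.le _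
    have hF2 : ContDiff ℝ 2 (fun z => ‖curl (u s) z‖ ^ 2) := hω2.norm_sq ℝ
    have hPs : P s = c • fun z => ‖curl (u s) z‖ ^ 2 := by
      funext z; simp only [hPdef, Pi.smul_apply, smul_eq_mul, hcdef]
    have hLap : (Δ (P s)) y = c * (2 * ⟪(Δ (curl (u s))) y, curl (u s) y⟫ +
        2 * frobeniusNormSq (fderiv ℝ (curl (u s)) y)) := by
      rw [hPs, InnerProductSpace.laplacian_smul c (hF2.contDiffAt), smul_eq_mul,
        laplacian_norm_sq_comp hω2 y]
    have hgrad : ∀ w, fderiv ℝ (P s) y w = c * (2 * ⟪curl (u s) y, fderiv ℝ (curl (u s)) y w⟫) := by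
      intro w
      rw [hPs, fderiv_const_smul ((hF2.differentiable (by norm_num)) y),
        FunLike.coe_smul, Pi.smul_apply, smul_eq_mul, fderiv_norm_sq_comp_apply hωd w]
    -- the strain bound in the form `⟪Du ω, ω⟫ ≤ (θ/(T−s)) |ω|²`
    have hκ : ⟪fderiv ℝ (u s) y (curl (u s) y), curl (u s) y⟫ ≤
        θ / (T - s) * ‖curl (u s) y‖ ^ 2 := by
      rw [div_mul_eq_mul_div, le_div_iff₀ hTs, mul_comm]
      exact hstrain s ⟨hs.1, hs'.2⟩ y (curl (u s) y)
    have hc' : (-1) * (2 * θ) * (T - s) ^ (2 * θ - 1) = -(2 * (θ / (T - s))) * c := by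
      rw [hcdef, Real.rpow_sub_one hTs.ne']
      field_simp
    have halg := strainWeight_algebra (hveq s hs' y)
      (frobeniusNormSq_nonneg (fderiv ℝ (curl (u s)) y)) hν.le hκ hc0 hc'
    -- assemble: `Pₜ ≤ ν ΔP − ∇P·u ≤ ν ΔP + K (1 + ‖y‖) ‖∇P‖`
    have hdrift : -(fderiv ℝ (P s) y (u s y)) ≤ K * (1 + ‖y‖) * ‖fderiv ℝ (P s) y‖ := by
      have h1 : -(fderiv ℝ (P s) y (u s y)) ≤ ‖fderiv ℝ (P s) y‖ * ‖u s y‖ :=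
        (neg_le_abs _).trans ((Real.norm_eq_abs _).symm.le.trans (ContinuousLinearMap.le_opNorm _ _))
      have h2 : ‖fderiv ℝ (P s) y‖ * ‖u s y‖ ≤ ‖fderiv ℝ (P s) y‖ * K :=
        mul_le_mul_of_nonneg_left (huK s ⟨hs'.1.le, hs.2⟩ y) (norm_nonneg _)
      have h3 : ‖fderiv ℝ (P s) y‖ * K ≤ K * (1 + ‖y‖) * ‖fderiv ℝ (P s) y‖ := by
        have : 0 ≤ K * ‖y‖ * ‖fderiv ℝ (P s) y‖ := by positivity
        nlinarith
      linarith
    show Pₜ s y ≤ ν * (Δ (P s)) y + K * (1 + ‖y‖) * ‖fderiv ℝ (P s) y‖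
    rw [hLap]
    have e1 : Pₜ s y = (-1) * (2 * θ) * (T - s) ^ (2 * θ - 1) * ‖curl (u s) y‖ ^ 2 +
        c * (2 * ⟪curl (u s) y, deriv (fun σ => curl (u σ) y) s⟫) := rfl
    rw [e1]
    have e2 := hgrad (u s y)
    linarith [halg, hdrift, e2]
  · -- bounded above on `[t₀, T₂] × ℝ³`
    intro s hs y
    have hs' := hIcc_sub hs
    have hTs : 0 < T - s := sub_pos.2 hs'.2
    have hw : (T - s) ^ (2 * θ) ≤ T ^ (2 * θ) :=
      Real.rpow_le_rpow hTs.le (by linarith [hs'.1]) (by positivity)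
    have hω : ‖curl (u s) y‖ ^ 2 ≤ (κ₀ * B₂) ^ 2 :=
      pow_le_pow_left₀ (norm_nonneg _) (hωB s ⟨hs'.1.le, hs.2⟩ y) 2
    exact mul_le_mul hw hω (sq_nonneg _) (Real.rpow_nonneg (ht₀.le.trans ht₀T.le) _)
  · -- the initial slice
    exact hPt₀

end Summit.NavierStokesRegularity.NavierStokesRegularity.Theorems

end
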